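/-
Copyright (c) 2026 the pub-hodgecm-mathlib formalisation cell (harness21).  Prover seat hodgecm-mathlib-K2-defs1 (g6), Track B, h413 = `stmt-HodgeConjecture-24833`, route `HCCMUnconditional`,
deal (252) of dealer K2E1-plan (g7) 2026-09-04T13:26:48Z («FILE 2d = the E1 `hline` DISCHARGE»; K2E4-p23's LETTER TABLE `K2/K2E4-p23/g2/LETTER-TABLE-D5prime-CM.K2E4-p23-g2.md`, row `hΛ hline hΛ1`).
-/
import Summits.HodgeConjecture.HodgeConjecture.Theorems.K2E1AnalyticLevelSetNullU      -- ★ (α) p860475 (K2E4-p23): `volume_levelSet_axis_eq_zero`, `measure_inter_setOf_forall_eq_zero_of_exists`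
import Mathlib.Analysis.Complex.CauchyIntegral
import HarnessLib

/-!
# (252) FILE 2d — `K2E1SymbolLineNoMassCMTwo`: THE `hline` LETTER OF ★ D5′ (`K2E1IrreducibleNoContinuousSpectrum[CMTwoOfLetters]`) FROM ONE NON-CONSTANT ENTIRE SYMBOL — the joint level sets
# `{x | ∀ j, s_j(x) = c_j}` of a symbol family read on the unitary axis `z = ½ + i(ℓ(x) + t₀)` are null for every measure whose coordinate `ℓ` pushes forward absolutely continuously to Lebesgue

Cell `pub/hodgecm-mathlib`, crux H413 = `stmt-HodgeConjecture-24833`.  THEOREMS ONLY (no `def`, no `instance`, no notation, no named-fact hypothesis, no `sorry`); lane `--supports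
stmt-HodgeConjecture-24833 --as helper` (count-neutral).  Closes no socket.  Mathlib + ★ (α) only (group-free); the symbol-family inputs are EXACTLY the clauses
`(∀ i, Differentiable ℂ (ŝ i))`, `(∃ z₁ z₂, ŝ i₀ z₁ ≠ ŝ i₀ z₂)` of ★ `K2E1ChiConvDataCMTwo.exists_chi_convData_cm_two` — now PAID for every `(χ_∞, ω)` by ★ p860525 `K2E1ArchSymbolCirclePhaseU2.hnc_gauge_cm_two`
(and at maximal level by ★ p860121) — and the output is K2E4-p23's binder **`hline : ∀ c : J → ℂ, m (Λ ∩ {x | ∀ j, s j x = c j}) = 0`** verbatim, with `s j x := ŝ j (½ + ((ℓ x + t₀ : ℝ) : ℂ)·I)`.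

THE MATHEMATICS ([ReedSimonI1980, §VII.2]; [MoeglinWaldspurger1995, IV.3.12]).  If `ŝ_{j₀}` is entire and non-constant, its level sets on the vertical line `re = ½` are Lebesgue-null (★ (α)
`volume_levelSet_axis_eq_zero`, identity principle); the joint level set of the family is contained in the `j₀`-level set (★ (α) `measure_inter_setOf_forall_eq_zero_of_exists`); and a measure `m` on
any model space `Ω` whose coordinate `ℓ : Ω → ℝ` satisfies `volume A = 0 ⟹ m (ℓ⁻¹ A) = 0` (Lebesgue on `ℝ`, its restrictions, `ℝ × K` with a product measure, the subtype `(0, ∞)`, …) sees the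
pulled-back joint level set as null.
* §1 `volume_levelSet_axis_eq_zero_of_differentiable` (one entire non-constant symbol, ★ (α) on `Ω = univ`), **`volume_jointLevelSet_axis_eq_zero`**.
* §2 `measurableSet_levelSet_axis`, **`hline_of_nonconstant_symbol`** (general `(Ω, m, ℓ)`, K2E4-p23's bytes), `hline_volume_of_nonconstant_symbol` (`Ω = ℝ`, `ℓ = id`),
  `hline_restrict_of_nonconstant_symbol` (`m = volume.restrict S`).
HONEST LABEL: HC_CM is proved only modulo the 7 printed citations (2 remaining named inputs: hLiu418 = `stmt-HodgeConjecture-24832`, h413 = `stmt-HodgeConjecture-24833`) until rung 0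
closes; count-neutral helper, closes no socket.

## References
* [ReedSimonI1980] M. Reed, B. Simon, *Methods of Modern Mathematical Physics I* (1980), §VII.2.  * [MoeglinWaldspurger1995] C. Mœglin, J.-L. Waldspurger, *Spectral Decomposition and
  Eisenstein Series* (1995), IV.3.12.
-/

set_option autoImplicit false
set_option linter.dupNamespace false  -- the mandated namespace repeats the summit's segment (`HodgeConjecture.HodgeConjecture`)

noncomputable section

open MeasureTheory Measure Set Filter Topology Complex
open Summit.HodgeConjecture.HodgeConjecture.Cruxes.H413.K2E1AnalyticLevelSetNullU (volume_levelSet_axis_eq_zero measure_inter_setOf_forall_eq_zero_of_exists)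

namespace Summit.HodgeConjecture.HodgeConjecture.Cruxes.H413.K2E1SymbolLineNoMassCMTwo

/-! ## §1 One entire non-constant symbol: its axis level sets, and the joint level sets of any family containing it, are Lebesgue-null -/

/-- **AXIS LEVEL SETS OF AN ENTIRE NON-CONSTANT SYMBOL ARE NULL**: ★ (α) `volume_levelSet_axis_eq_zero` on `Ω = univ` for a `Differentiable ℂ` symbol with two distinct values (the clause shape of
★ convData_χ ∕ ★ `hnc_gauge_cm_two`). [cite: ReedSimonI1980, §VII.2] -/
theorem volume_levelSet_axis_eq_zero_of_differentiable {s : ℂ → ℂ} (hd : Differentiable ℂ s) (hnc : ∃ z₁ z₂ : ℂ, s z₁ ≠ s z₂) (t₀ : ℝ) (c : ℂ) :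
    volume {y : ℝ | s ((1 / 2 : ℂ) + ((y + t₀ : ℝ) : ℂ) * Complex.I) = c} = 0 := by
  obtain ⟨z₁, z₂, hne⟩ := hnc
  exact volume_levelSet_axis_eq_zero isPreconnected_univ (Complex.analyticOnNhd_univ_iff_differentiable.2 hd) t₀ (fun _ => mem_univ _) ⟨z₁, mem_univ _, z₂, mem_univ _, hne⟩ c

/-- **JOINT LEVEL SETS OF A SYMBOL FAMILY WITH ONE ENTIRE NON-CONSTANT MEMBER ARE NULL ON THE AXIS**: `volume {y | ∀ j, ŝ_j(½ + i(y + t₀)) = c_j} = 0`. [cite: ReedSimonI1980, §VII.2] -/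
theorem volume_jointLevelSet_axis_eq_zero {J : Type*} (ŝ : J → ℂ → ℂ) (j₀ : J) (hd : Differentiable ℂ (ŝ j₀)) (hnc : ∃ z₁ z₂ : ℂ, ŝ j₀ z₁ ≠ ŝ j₀ z₂) (t₀ : ℝ) (c : J → ℂ) :
    volume {y : ℝ | ∀ j, ŝ j ((1 / 2 : ℂ) + ((y + t₀ : ℝ) : ℂ) * Complex.I) = c j} = 0 := by
  have h := measure_inter_setOf_forall_eq_zero_of_exists volume (fun j (y : ℝ) => ŝ j ((1 / 2 : ℂ) + ((y + t₀ : ℝ) : ℂ) * Complex.I)) c univ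
    ⟨j₀, by rw [univ_inter]; exact volume_levelSet_axis_eq_zero_of_differentiable hd hnc t₀ (c j₀)⟩
  rwa [univ_inter] at h

/-! ## §2 K2E4-p23's `hline` on a general model `(Ω, m)` with an absolutely continuous coordinate `ℓ : Ω → ℝ` -/

/-- The axis level set of a continuous symbol is measurable (it is closed). [folklore] -/
theorem measurableSet_levelSet_axis {s : ℂ → ℂ} (hs : Continuous s) (t₀ : ℝ) (c : ℂ) :
    MeasurableSet {y : ℝ | s ((1 / 2 : ℂ) + ((y + t₀ : ℝ) : ℂ) * Complex.I) = c} :=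
  (isClosed_eq (hs.comp (continuous_const.add ((Complex.continuous_ofReal.comp (continuous_id.add continuous_const)).mul continuous_const))) continuous_const).measurableSet

/-- **`hline` FROM ONE NON-CONSTANT ENTIRE SYMBOL** (K2E4-p23's binder, general model): let `m` be a measure on `Ω` and `ℓ : Ω → ℝ` a coordinate with `volume A = 0 ⟹ m (ℓ⁻¹ A) = 0` for measurable `A`
(e.g. `m.map ℓ ≪ volume`); let `ŝ : J → ℂ → ℂ` have a member `ŝ_{j₀}` entire and non-constant, and read the symbols on the axis, `s j x := ŝ j (½ + i(ℓ x + t₀))`.  Then for every line part `Λ`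
and every `c`, `m (Λ ∩ {x | ∀ j, s j x = c j}) = 0`. [cite: ReedSimonI1980, §VII.2] [cite: MoeglinWaldspurger1995, IV.3.12] -/
theorem hline_of_nonconstant_symbol {Ω : Type*} [MeasurableSpace Ω] (m : Measure Ω) {ℓ : Ω → ℝ}
    (hac : ∀ A : Set ℝ, MeasurableSet A → volume A = 0 → m (ℓ ⁻¹' A) = 0)
    {J : Type*} (ŝ : J → ℂ → ℂ) (j₀ : J) (hd : Differentiable ℂ (ŝ j₀)) (hnc : ∃ z₁ z₂ : ℂ, ŝ j₀ z₁ ≠ ŝ j₀ z₂) (t₀ : ℝ) (Λ : Set Ω) :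
    ∀ c : J → ℂ, m (Λ ∩ {x | ∀ j, ŝ j ((1 / 2 : ℂ) + ((ℓ x + t₀ : ℝ) : ℂ) * Complex.I) = c j}) = 0 := by
  intro c
  refine measure_inter_setOf_forall_eq_zero_of_exists m (fun j (x : Ω) => ŝ j ((1 / 2 : ℂ) + ((ℓ x + t₀ : ℝ) : ℂ) * Complex.I)) c Λ ⟨j₀, ?_⟩
  refine measure_mono_null inter_subset_right ?_
  exact hac {y : ℝ | ŝ j₀ ((1 / 2 : ℂ) + ((y + t₀ : ℝ) : ℂ) * Complex.I) = c j₀} (measurableSet_levelSet_axis hd.continuous t₀ (c j₀))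
    (volume_levelSet_axis_eq_zero_of_differentiable hd hnc t₀ (c j₀))

/-- **`hline` ON `Ω = ℝ` WITH LEBESGUE MEASURE** (`ℓ = id`): `∀ c, volume (Λ ∩ {y | ∀ j, ŝ j (½ + i(y + t₀)) = c j}) = 0`. [cite: ReedSimonI1980, §VII.2] -/
theorem hline_volume_of_nonconstant_symbol {J : Type*} (ŝ : J → ℂ → ℂ) (j₀ : J) (hd : Differentiable ℂ (ŝ j₀)) (hnc : ∃ z₁ z₂ : ℂ, ŝ j₀ z₁ ≠ ŝ j₀ z₂) (t₀ : ℝ) (Λ : Set ℝ) :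
    ∀ c : J → ℂ, volume (Λ ∩ {y : ℝ | ∀ j, ŝ j ((1 / 2 : ℂ) + ((y + t₀ : ℝ) : ℂ) * Complex.I) = c j}) = 0 :=
  hline_of_nonconstant_symbol volume (ℓ := id) (fun _ _ hA => hA) ŝ j₀ hd hnc t₀ Λ

/-- **`hline` FOR A RESTRICTED LEBESGUE MEASURE** (`m = volume.restrict S`, e.g. `S = (0, ∞)`): `∀ c, m (Λ ∩ {y | ∀ j, ŝ j (½ + i(y + t₀)) = c j}) = 0`. [cite: ReedSimonI1980, §VII.2] -/
theorem hline_restrict_of_nonconstant_symbol {J : Type*} (S : Set ℝ) (ŝ : J → ℂ → ℂ) (j₀ : J) (hd : Differentiable ℂ (ŝ j₀)) (hnc : ∃ z₁ z₂ : ℂ, ŝ j₀ z₁ ≠ ŝ j₀ z₂)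
    (t₀ : ℝ) (Λ : Set ℝ) :
    ∀ c : J → ℂ, volume.restrict S (Λ ∩ {y : ℝ | ∀ j, ŝ j ((1 / 2 : ℂ) + ((y + t₀ : ℝ) : ℂ) * Complex.I) = c j}) = 0 :=
  hline_of_nonconstant_symbol (volume.restrict S) (ℓ := id) (fun A _ hA => le_antisymm ((Measure.restrict_le_self A).trans hA.le) bot_le) ŝ j₀ hd hnc t₀ Λ

/-- **`hline` THROUGH A MEASURABLE COORDINATE WITH ABSOLUTELY CONTINUOUS PUSH-FORWARD** (`m.map ℓ ≪ volume`, `ℓ` measurable — products `ℝ × K`, subtypes, …). [cite: ReedSimonI1980, §VII.2] -/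
theorem hline_of_map_absolutelyContinuous {Ω : Type*} [MeasurableSpace Ω] (m : Measure Ω) {ℓ : Ω → ℝ} (hℓ : Measurable ℓ) (hac : m.map ℓ ≪ volume)
    {J : Type*} (ŝ : J → ℂ → ℂ) (j₀ : J) (hd : Differentiable ℂ (ŝ j₀)) (hnc : ∃ z₁ z₂ : ℂ, ŝ j₀ z₁ ≠ ŝ j₀ z₂) (t₀ : ℝ) (Λ : Set Ω) :
    ∀ c : J → ℂ, m (Λ ∩ {x | ∀ j, ŝ j ((1 / 2 : ℂ) + ((ℓ x + t₀ : ℝ) : ℂ) * Complex.I) = c j}) = 0 :=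
  hline_of_nonconstant_symbol m (fun A hA h0 => by rw [← Measure.map_apply hℓ hA]; exact hac h0) ŝ j₀ hd hnc t₀ Λ

end Summit.HodgeConjecture.HodgeConjecture.Cruxes.H413.K2E1SymbolLineNoMassCMTwo
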